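import Literature.NumberTheory.EllipticCurves.ModularCurveSturmProofs
import Literature.NumberTheory.EllipticCurves.ModularFormsRamanujan
import Mathlib.NumberTheory.ModularForms.EisensteinSeries.Basic
import HarnessLib

/-!
# `M(Γ₀(N)) = ⊕ₖ M_k(Γ₀(N))` is a free module over `M(SL₂(ℤ)) = ℂ[E₄, E₆]`, on at most
  `μ = [SL₂(ℤ) : Γ₀(N)]` homogeneous generators
  (trunk EllArithM, item C17; first file of an elementary route to the existence half
  `g(X₀(N)) ≤ dim S₂(Γ₀(N))` of the dimension formula `finrank_cuspForm_two_eq_genusX0`)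

`ModularCurveGenusIntegralityProofs` reduces the named fact `finrank_cuspForm_two_eq_genusX0 N`
(`dim S₂(Γ₀(N)) = g(X₀(N))`, Diamond–Shurman Thm. 3.5.1), and with it the Eichler–Shimura lattice /
`Ω^±_f > 0` chain of `ModularSymbolsManin`, to the *existence* of `g(X₀(N))` linearly independent
weight-`2` cusp forms, classically Riemann–Roch on `X₀(N)`. This file starts a route to that
existence statement for **every** `N` which uses neither Riemann surfaces nor the valence
formula: the structure theory of `M(Γ₀(N))` as a graded module over the ring of level-one forms
(the case `ρ = Ind_{Γ₀(N)}^{SL₂(ℤ)} 1` of the free-module theorem for vector-valued modular forms,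
Marks–Mason 2010 Thm. 1, Gannon 2014 Thm. 3.4(a)). The plan of the route (three files):

1. (this file) `M(Γ₀(N))` is free over `ℂ[E₄, E₆]` on homogeneous generators `F_1, …, F_r` of
   even weights `k_1, …, k_r`, `r ≤ μ`;
2. (determinant file) `r = μ`, and the weights satisfy Gannon's Thm. 3.4(b):
   `#{k_j ≡ 0 (4)} = (μ + ν₂)/2`, `#{k_j ≡ 0 (6)} = (μ + 2ν₃)/3`,
   `#{k_j ≡ 2 (6)} = #{k_j ≡ 4 (6)} = (μ - ν₃)/3`, `∑ k_j = 6(μ - ν_∞)` — from the determinant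
   `𝒟 = det (F_j ∣ γ_a)_{a,j}` over coset representatives, whose Serre derivative vanishes
   (`tr` of the connection matrix lies in `M₂(SL₂(ℤ)) = 0`), so that `𝒟¹² = cΔ^{∑k_j}` has no zero;
3. (genus file) bookkeeping: these constraints force `dim M₂(Γ₀(N)) = #{k_j = 2} ≥ g - 1 + ν_∞`,
   and the residue relation (trace to level one, `M₂(SL₂(ℤ)) = 0`) gives `dim S₂(Γ₀(N)) ≥ g`.

## Main results (all `N ≥ 1`; `A_k := M_k(Γ₀(N))`, `R_w := M_w(SL₂(ℤ))` as spaces of functions)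

* `formSpace Γ k ⊆ (ℍ → ℂ)`, the functions of `ModularForm Γ k` (`formSpaceEquiv`,
  `mem_formSpace_iff`: holomorphic, `Γ`-invariant, all `SL₂(ℤ)`-translates bounded at `i∞`), so
  that forms of different weights and levels can be multiplied; `levelOneSpace w = formSpace 𝒮ℒ w`,
  `gamma0Space N k = formSpace Γ₀(N) k`.
* Level one (Mathlib's `E₄`, `E₆`, `Δ`, dimension formula; limits at `i∞` from the tree's
  `UniformizationProofs.tendsto_E_atImInfty` via `ModularFormsRamanujan`):
  `E4_ne_zero_or_E6_ne_zero` (no common zero, as `1728Δ = E₄³ - E₆²`),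
  `levelOneSpace_le_sup`: **`R_w ⊆ E₄R_{w-4} + E₆R_{w-6}` for `w ≠ 0`** (kill the constant term,
  divide the cusp form by `Δ` with `CuspForm.discriminantEquiv`, use `1728Δ = E₄·E₄² - E₆·E₆`).
* `eq_zero_of_mul_eq_zero_of_mdifferentiable` (identity theorem on `ℍ`) and the **division lemma**
  `exists_eq_E6_mul_of_E4_mul_eq`: `E₄h = E₆f`, `h ∈ A_k`, `f ∈ A_{k-2}` ⟹ `h ∈ E₆A_{k-6}`
  (`h/E₆ = f/E₄` is holomorphic since `E₄, E₆` have no common zero, and bounded at the cusps since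
  `E₆ → 1`); i.e. `E₄, E₆` is a regular sequence on `M(Γ₀(N))`.
* Generators: `gen N k` = a basis of a complement of `decomp N k = E₄A_{k-4} + E₆A_{k-6}` in `A_k`
  (`exists_generators`, finite-dimensionality by Sturm's bound from `ModularCurveSturmProofs`);
  `exists_coeffs` (**spanning**: `A_m = ∑_j R_{m-k_j}F_j`, induction on the weight) and
  `coeffs_eq_zero` (**independence**: a relation `∑ p_jF_j = 0`, `p_j ∈ R_{m-k_j}`, is trivial —
  graded Nakayama by hand: the constants among the `p_j` vanish by the complement property, then
  `E₄X = -E₆Y` is divided by the division lemma and the induction hypothesis in weights `m - 4`,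
  `m - 6` applies).
* Counting: `card_genBelow_le` — **at most `μ` generators** (the injection
  `⊕_j R_{M-k_j} ↪ A_M`, `dim R_w ≥ ⌊w/12⌋` (Mathlib `dimension_level_one`) against
  `dim A_M ≤ Mμ/12 + 1` (Sturm), `M → ∞`), hence finitely many (`exists_fst_le`).
* `IsLevelOneBasis N wt F` and **`exists_isLevelOneBasis`**: a finite family `F : Fin r → (ℍ → ℂ)`,
  `F_i ∈ A_{k_i}`, `k_i ≥ 0` even, `r ≤ μ`, such that every `f ∈ A_m` is uniquely
  `∑_i p_iF_i` with `p_i ∈ R_{m-k_i}`.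

No new named facts; the definitions are auxiliary (`formSpace`, `decomp`, `numGen`, `gen`,
`GenIndex`, `genBelow`, `IsLevelOneBasis`).

## References

* T. Gannon, *The theory of vector-valued modular forms for the modular group*, in: Conformal
  Field Theory, Automorphic Forms and Related Topics (Heidelberg 2011), Contrib. Math. Comput.
  Sci. 8, Springer (2014), 247–286 (arXiv:1310.4458): Thm. 3.4 (a) freeness of rank `d` over
  `ℂ[E₄, E₆]`, (b) the weight multiplicities and `∑ w^{(j)} = 12 Tr λ`, `det = Δ^{Tr λ}`; §3.5
  (dimension formula, "induction trick" for finite-index subgroups).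
* C. Marks, G. Mason, *Structure of the module of vector-valued modular forms*, J. London Math.
  Soc. (2) 82 (2010), 32–48 (arXiv:0901.4367), Thm. 1.
* F. Diamond, J. Shurman, *A first course in modular forms*, GTM 228, Springer (2005), Thm. 3.5.1.
-/

noncomputable section

open UpperHalfPlane hiding I
open ModularForm Complex Matrix.SpecialLinearGroup Filter Asymptotics CongruenceSubgroup
  EisensteinSeries
open scoped MatrixGroups Real ModularForm Topology Manifold

namespace Literature.NumberTheory.EllipticCurves.ModularForms

/-! ### Spaces of modular forms as spaces of functions -/

section FormSpace

variable (Γ : Subgroup (GL (Fin 2) ℝ)) [Γ.HasDetOne] (k : ℤ)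

/-- The space `M_k(Γ)` of weight-`k` modular forms of level `Γ`, as the `ℂ`-subspace of
functions `ℍ → ℂ` underlying Mathlib's `ModularForm Γ k` (so that forms of different weights and
levels can be multiplied and compared as functions). [folklore] -/
def formSpace : Submodule ℂ (ℍ → ℂ) where
  carrier := {f | ∃ F : ModularForm Γ k, ⇑F = f}
  add_mem' := by
    rintro _ _ ⟨F, rfl⟩ ⟨G, rfl⟩
    exact ⟨F + G, rfl⟩
  zero_mem' := ⟨0, rfl⟩
  smul_mem' := by
    rintro c _ ⟨F, rfl⟩
    exact ⟨c • F, rfl⟩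

variable {Γ k}

/-- Membership in `formSpace`. [folklore] -/
theorem mem_formSpace {f : ℍ → ℂ} : f ∈ formSpace Γ k ↔ ∃ F : ModularForm Γ k, ⇑F = f := Iff.rfl

/-- The function of a modular form lies in the form space. [folklore] -/
theorem coe_mem_formSpace (F : ModularForm Γ k) : ⇑F ∈ formSpace Γ k := ⟨F, rfl⟩

variable (Γ k) in
/-- `ModularForm Γ k ≃ formSpace Γ k` (a modular form is determined by its function). [folklore] -/
def formSpaceEquiv : ModularForm Γ k ≃ₗ[ℂ] formSpace Γ k :=
  LinearEquiv.ofBijective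
    (LinearMap.codRestrict (formSpace Γ k)
      ({ toFun := fun F ↦ ⇑F
         map_add' := fun _ _ ↦ rfl
         map_smul' := fun _ _ ↦ rfl } : ModularForm Γ k →ₗ[ℂ] (ℍ → ℂ)) coe_mem_formSpace)
    ⟨fun _ _ h ↦ DFunLike.coe_injective (congrArg Subtype.val h),
      fun ⟨_, F, hF⟩ ↦ ⟨F, Subtype.ext hF⟩⟩

/-- `formSpaceEquiv` is the coercion to functions. [folklore] -/
@[simp] theorem formSpaceEquiv_apply (F : ModularForm Γ k) :
    ((formSpaceEquiv Γ k F : formSpace Γ k) : ℍ → ℂ) = ⇑F := rfl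

variable (Γ k) in
/-- `dim formSpace Γ k = dim M_k(Γ)`. [folklore] -/
theorem finrank_formSpace :
    Module.finrank ℂ (formSpace Γ k) = Module.finrank ℂ (ModularForm Γ k) :=
  (formSpaceEquiv Γ k).finrank_eq.symm

/-- Finite-dimensionality transfers. [folklore] -/
theorem finiteDimensional_formSpace [FiniteDimensional ℂ (ModularForm Γ k)] :
    FiniteDimensional ℂ (formSpace Γ k) :=
  LinearEquiv.finiteDimensional (formSpaceEquiv Γ k)

/-- **Membership criterion** for an arithmetic group `Γ`: a function is (the function of) a modular
form of weight `k` and level `Γ` iff it is holomorphic, `Γ`-invariant for `∣[k]`, and all its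
`SL₂(ℤ)`-translates are bounded at `i∞` (the cusps of `Γ` being `SL₂(ℤ) · ∞`). [folklore] -/
theorem mem_formSpace_iff [Γ.IsArithmetic] {f : ℍ → ℂ} :
    f ∈ formSpace Γ k ↔ MDiff f ∧ (∀ γ ∈ Γ, f ∣[k] γ = f) ∧
      ∀ g : SL(2, ℤ), IsBoundedAtImInfty (f ∣[k] (g : GL (Fin 2) ℝ)) := by
  constructor
  · rintro ⟨F, rfl⟩
    refine ⟨F.holo', fun γ hγ ↦ F.slash_action_eq' γ hγ, fun g ↦ ?_⟩
    simpa [SL_slash] using ModularFormClass.bdd_at_infty_slash F g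
  · rintro ⟨hhol, hinv, hbdd⟩
    refine ⟨{ toFun := f
              slash_action_eq' := fun γ hγ ↦ hinv γ hγ
              holo' := hhol
              bdd_at_cusps' := fun {c} hc ↦ ?_ }, rfl⟩
    rw [Subgroup.IsArithmetic.isCusp_iff_isCusp_SL2Z] at hc
    rw [OnePoint.isBoundedAt_iff_forall_SL2Z hc]
    intro γ _
    exact hbdd γ

/-- Holomorphy of members of the form space. [folklore] -/
theorem mdifferentiable_of_mem_formSpace {f : ℍ → ℂ} (hf : f ∈ formSpace Γ k) : MDiff f := by
  obtain ⟨F, rfl⟩ := hf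
  exact F.holo'

/-- Invariance of members of the form space. [folklore] -/
theorem slash_eq_of_mem_formSpace {f : ℍ → ℂ} (hf : f ∈ formSpace Γ k) {γ : GL (Fin 2) ℝ}
    (hγ : γ ∈ Γ) : f ∣[k] γ = f := by
  obtain ⟨F, rfl⟩ := hf
  exact F.slash_action_eq' γ hγ

/-- Boundedness at `i∞` of all `SL₂(ℤ)`-translates of members of the form space. [folklore] -/
theorem isBoundedAtImInfty_slash_of_mem_formSpace [Γ.IsArithmetic] {f : ℍ → ℂ}
    (hf : f ∈ formSpace Γ k) (g : SL(2, ℤ)) :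
    IsBoundedAtImInfty (f ∣[k] (g : GL (Fin 2) ℝ)) :=
  ((mem_formSpace_iff.mp hf).2.2 g)

/-- Products: `M_{k₁}(Γ) · M_{k₂}(Γ) ⊆ M_{k₁+k₂}(Γ)`. [folklore] -/
theorem mul_mem_formSpace {k₁ k₂ : ℤ} {f g : ℍ → ℂ} (hf : f ∈ formSpace Γ k₁)
    (hg : g ∈ formSpace Γ k₂) : f * g ∈ formSpace Γ (k₁ + k₂) := by
  obtain ⟨F, rfl⟩ := hf
  obtain ⟨G, rfl⟩ := hg
  exact ⟨F.mul G, rfl⟩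

/-- Powers: `M_k(Γ)^n ⊆ M_{nk}(Γ)`. [folklore] -/
theorem pow_mem_formSpace {f : ℍ → ℂ} (hf : f ∈ formSpace Γ k) (n : ℕ) :
    f ^ n ∈ formSpace Γ (n * k) := by
  induction n with
  | zero =>
    simp only [pow_zero, Nat.cast_zero, zero_mul]
    exact ⟨1, ModularForm.one_coe_eq_one⟩
  | succ n ih =>
    rw [pow_succ, show ((n + 1 : ℕ) : ℤ) * k = n * k + k by push_cast; ring]
    exact mul_mem_formSpace ih hf

/-- Level lowering: for arithmetic `Γ ≤ Γ'`, `M_k(Γ') ⊆ M_k(Γ)`. [folklore] -/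
theorem formSpace_mono {Γ' : Subgroup (GL (Fin 2) ℝ)} [Γ'.HasDetOne] [Γ.IsArithmetic]
    [Γ'.IsArithmetic] (h : Γ ≤ Γ') : formSpace Γ' k ≤ formSpace Γ k := by
  intro f hf
  rw [mem_formSpace_iff] at hf ⊢
  exact ⟨hf.1, fun γ hγ ↦ hf.2.1 γ (h hγ), hf.2.2⟩

/-- Negative weights: `M_k(Γ) = 0` for `k < 0` (Mathlib `ModularForm.isZero_of_neg_weight`). [folklore] -/
theorem formSpace_eq_bot_of_neg [Γ.IsArithmetic] (hk : k < 0) : formSpace Γ k = ⊥ := by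
  rw [Submodule.eq_bot_iff]
  rintro _ ⟨F, rfl⟩
  rw [ModularForm.isZero_of_neg_weight hk F]
  rfl

/-- Odd weights: `M_k(Γ) = 0` for odd `k` when `-1 ∈ Γ`. [folklore] -/
theorem formSpace_eq_bot_of_odd (hΓ : (-1 : GL (Fin 2) ℝ) ∈ Γ) (hk : Odd k) :
    formSpace Γ k = ⊥ := by
  rw [Submodule.eq_bot_iff]
  rintro _ ⟨F, rfl⟩
  rw [ModularForm.eq_zero_of_neg_one_mem hΓ hk F]
  rfl

end FormSpace

/-! ### Level one: `E₄`, `E₆`, `Δ`, values at `i` and at `i∞` -/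

section LevelOne

/-- Notation-free abbreviation: the level-one form space `R_w = M_w(SL₂(ℤ))`. [folklore] -/
abbrev levelOneSpace (w : ℤ) : Submodule ℂ (ℍ → ℂ) := formSpace 𝒮ℒ w

/-- `E₄ ∈ R₄`. [folklore] -/
theorem E4_mem : (⇑E₄ : ℍ → ℂ) ∈ levelOneSpace 4 := coe_mem_formSpace E₄

/-- `E₆ ∈ R₆`. [folklore] -/
theorem E6_mem : (⇑E₆ : ℍ → ℂ) ∈ levelOneSpace 6 := coe_mem_formSpace E₆

/-- `E₄(z) → 1` as `Im z → ∞` (alias of the tree's `tendsto_E_atImInfty`, `UniformizationProofs`,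
in the `E₄` spelling used below). [folklore] -/
theorem tendsto_E4_atImInfty : Tendsto (⇑E₄ : ℍ → ℂ) atImInfty (𝓝 1) :=
  ModularForm.tendsto_E_atImInfty _ ⟨2, rfl⟩

/-- `E₆(z) → 1` as `Im z → ∞` (alias of `tendsto_E_atImInfty`). [folklore] -/
theorem tendsto_E6_atImInfty : Tendsto (⇑E₆ : ℍ → ℂ) atImInfty (𝓝 1) :=
  ModularForm.tendsto_E_atImInfty _ ⟨3, rfl⟩

/-- `E₄` and `E₆` have no common zero on `ℍ` (since `1728Δ = E₄³ - E₆²` and `Δ ≠ 0`). [folklore] -/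
theorem E4_ne_zero_or_E6_ne_zero (z : ℍ) : E₄ z ≠ 0 ∨ E₆ z ≠ 0 := by
  by_contra! h
  have hΔ := discriminant_eq_E₄_cube_sub_E₆_sq z
  rw [h.1, h.2] at hΔ
  norm_num at hΔ
  exact discriminant_ne_zero z hΔ

/-- The discriminant in terms of `E₄, E₆` as functions: `1728 Δ = E₄³ - E₆²`. [folklore] -/
theorem discriminant_eq_fun :
    ModularForm.discriminant =
      (1728 : ℂ)⁻¹ • ((⇑E₄ : ℍ → ℂ) * (⇑E₄ * ⇑E₄) - ⇑E₆ * ⇑E₆) := by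
  funext z
  simp only [Pi.smul_apply, Pi.sub_apply, Pi.mul_apply, smul_eq_mul]
  rw [ModularForm.discriminant_eq_E₄_cube_sub_E₆_sq z]
  ring

/-- A level-one form of weight `w` with a nonzero limit at `i∞` exists in every even weight
`w ≥ 4`, and can be taken in `E₄ · R_{w-4} + E₆ · R_{w-6}`: namely `E₄ · E_{w-4}` (`w ≠ 6`) or
`E₆` (`w = 6`). [folklore] -/
theorem exists_levelOne_tendsto_one {w : ℕ} (hw : 4 ≤ w) (hw2 : Even w) :
    ∃ m : ℍ → ℂ, m ∈ (levelOneSpace ((w : ℤ) - 4)).map (LinearMap.mulLeft ℂ (⇑E₄ : ℍ → ℂ)) ⊔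
        (levelOneSpace ((w : ℤ) - 6)).map (LinearMap.mulLeft ℂ (⇑E₆ : ℍ → ℂ)) ∧
      m ∈ levelOneSpace w ∧ Tendsto m atImInfty (𝓝 1) := by
  rcases eq_or_ne w 6 with rfl | h6
  · refine ⟨⇑E₆, Submodule.mem_sup_right ⟨1, ?_, by simp⟩, E6_mem, tendsto_E6_atImInfty⟩
    rw [show ((6 : ℕ) : ℤ) - 6 = 0 by norm_num]
    exact ⟨1, ModularForm.one_coe_eq_one⟩
  rcases eq_or_ne w 4 with rfl | h4
  · refine ⟨⇑E₄, Submodule.mem_sup_left ⟨1, ?_, by simp⟩, E4_mem, tendsto_E4_atImInfty⟩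
    rw [show ((4 : ℕ) : ℤ) - 4 = 0 by norm_num]
    exact ⟨1, ModularForm.one_coe_eq_one⟩
  -- `w ≥ 8`: take `E₄ · E_{w-4}`
  obtain ⟨r, hr⟩ := hw2
  have hw' : 3 ≤ w - 4 := by omega
  have hw2' : Even (w - 4) := ⟨r - 2, by omega⟩
  have hE : Tendsto (⇑(E hw') : ℍ → ℂ) atImInfty (𝓝 1) := by
    have := ModularForm.levelOne_tendsto_atImInfty (E hw')
    rwa [E_qExpansion_coeff_zero hw' hw2'] at this
  have hcast : (((w - 4 : ℕ) : ℤ)) = (w : ℤ) - 4 := by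
    rw [Nat.cast_sub (by omega)]
    norm_num
  refine ⟨⇑E₄ * ⇑(E hw'), Submodule.mem_sup_left ⟨⇑(E hw'), ?_, rfl⟩, ?_, ?_⟩
  · exact hcast ▸ coe_mem_formSpace (E hw')
  · have := mul_mem_formSpace E4_mem (hcast ▸ coe_mem_formSpace (E hw') :
      (⇑(E hw') : ℍ → ℂ) ∈ levelOneSpace ((w : ℤ) - 4))
    rwa [show (4 : ℤ) + ((w : ℤ) - 4) = w by ring] at this
  · rw [show (⇑E₄ * ⇑(E hw') : ℍ → ℂ) = fun z ↦ E₄ z * (E hw') z from rfl]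
    simpa using tendsto_E4_atImInfty.mul hE

/-- A level-one modular form tending to `0` at `i∞` is a cusp form (one cusp). [folklore] -/
def levelOneCuspFormOfTendsto {w : ℤ} (F : ModularForm 𝒮ℒ w)
    (h0 : Tendsto (⇑F) atImInfty (𝓝 0)) : CuspForm 𝒮ℒ w where
  toFun := F
  slash_action_eq' := F.slash_action_eq'
  holo' := F.holo'
  zero_at_cusps' hc := by
    rw [Subgroup.IsArithmetic.isCusp_iff_isCusp_SL2Z] at hc
    rw [OnePoint.isZeroAt_iff_forall_SL2Z hc]
    intro γ _
    have hinv := F.slash_action_eq' (γ : GL (Fin 2) ℝ) ⟨γ, rfl⟩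
    simp only [SlashInvariantForm.toFun_eq_coe, toSlashInvariantForm_coe] at hinv
    simp only [SL_slash, hinv]
    exact h0

/-- **`R_w ⊆ E₄ R_{w-4} + E₆ R_{w-6}` for `w ≠ 0`** (`R = M(SL₂(ℤ))`): the graded maximal ideal
of `ℂ[E₄, E₆]` is generated by `E₄, E₆`. Proof without the structure theorem: subtract a multiple
of `E₄E_{w-4}` (or `E₆`) to kill the constant term, divide the resulting cusp form by `Δ`
(Mathlib `CuspForm.discriminantEquiv`) and use `1728Δ = E₄·E₄² - E₆·E₆`. [folklore] -/
theorem levelOneSpace_le_sup {w : ℤ} (hw : w ≠ 0) :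
    levelOneSpace w ≤ (levelOneSpace (w - 4)).map (LinearMap.mulLeft ℂ (⇑E₄ : ℍ → ℂ)) ⊔
      (levelOneSpace (w - 6)).map (LinearMap.mulLeft ℂ (⇑E₆ : ℍ → ℂ)) := by
  -- dispose of `w < 0`, `w` odd, `w = 2`
  rcases lt_or_ge w 0 with hneg | hnonneg
  · rw [show levelOneSpace w = ⊥ from formSpace_eq_bot_of_neg hneg]
    exact bot_le
  rcases Int.even_or_odd w with heven | hodd
  swap
  · rw [show levelOneSpace w = ⊥ from
      formSpace_eq_bot_of_odd (⟨-1, by ext; simp⟩ : (-1 : GL (Fin 2) ℝ) ∈ 𝒮ℒ) hodd]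
    exact bot_le
  rcases eq_or_ne w 2 with rfl | h2
  · rintro _ ⟨F, rfl⟩
    rw [rank_zero_iff_forall_zero.mp ModularForm.levelOne_weight_two_rank_zero F]
    exact Submodule.zero_mem _
  -- now `w ≥ 4` even
  obtain ⟨n, rfl⟩ : ∃ n : ℕ, w = n := ⟨w.toNat, (Int.toNat_of_nonneg hnonneg).symm⟩
  have hn4 : 4 ≤ n := by
    rcases heven with ⟨r, hr⟩
    omega
  obtain ⟨m, hm, hmw, hm1⟩ := exists_levelOne_tendsto_one hn4 (by exact_mod_cast heven)
  rintro _ ⟨F, rfl⟩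
  obtain ⟨M, hM⟩ := hmw
  set c : ℂ := (qExpansion 1 F).coeff 0 with hc
  -- `F - c • M → 0`
  have hlim : Tendsto (⇑(F - c • M)) atImInfty (𝓝 0) := by
    have h1 := ModularForm.levelOne_tendsto_atImInfty F
    have h2 : Tendsto (⇑M) atImInfty (𝓝 1) := hM ▸ hm1
    have := h1.sub (h2.const_mul c)
    simp only [mul_one, ← hc, sub_self] at this
    convert this using 1
    funext z
    simp [smul_eq_mul]
  set G : CuspForm 𝒮ℒ (n : ℤ) := levelOneCuspFormOfTendsto (F - c • M) hlim with hG
  have hΔ : ∀ z, ModularForm.discriminant z * (CuspForm.discriminantEquiv G) z = (F - c • M) z :=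
    fun z ↦ ModularForm.discriminant_mul_discriminantEquiv_apply G z
  set P := CuspForm.discriminantEquiv G with hP
  have hPmem : (⇑P : ℍ → ℂ) ∈ levelOneSpace ((n : ℤ) - 12) := coe_mem_formSpace P
  -- decomposition
  have hF : (⇑F : ℍ → ℂ) = c • m + ((1728 : ℂ)⁻¹ • (⇑E₄ * (⇑E₄ * ⇑E₄ * ⇑P)) -
      (1728 : ℂ)⁻¹ • (⇑E₆ * (⇑E₆ * ⇑P))) := by
    funext z
    have hz := hΔ z
    rw [ModularForm.discriminant_eq_E₄_cube_sub_E₆_sq z] at hz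
    simp only [ModularForm.sub_apply, IsGLPos.smul_apply, smul_eq_mul] at hz
    simp only [Pi.add_apply, Pi.sub_apply, Pi.smul_apply, Pi.mul_apply, smul_eq_mul, ← hM]
    linear_combination -hz
  rw [hF]
  refine Submodule.add_mem _ (Submodule.smul_mem _ _ hm) (Submodule.sub_mem _ ?_ ?_)
  · refine Submodule.smul_mem _ _ (Submodule.mem_sup_left ⟨⇑E₄ * ⇑E₄ * ⇑P, ?_, rfl⟩)
    have := mul_mem_formSpace (mul_mem_formSpace E4_mem E4_mem) hPmem
    rwa [show (4 : ℤ) + 4 + ((n : ℤ) - 12) = n - 4 by ring] at this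
  · refine Submodule.smul_mem _ _ (Submodule.mem_sup_right ⟨⇑E₆ * ⇑P, ?_, rfl⟩)
    have := mul_mem_formSpace E6_mem hPmem
    rwa [show (6 : ℤ) + ((n : ℤ) - 12) = n - 6 by ring] at this

end LevelOne

/-! ### Two analytic lemmas: no zero divisors, and division (`E₄`, `E₆` have no common zero) -/

section Division

/-- A nonzero holomorphic function on `ℍ` is not a zero divisor against continuous functions
(identity theorem on the connected open set `ℍ ⊆ ℂ`). [folklore] -/
theorem eq_zero_of_mul_eq_zero_of_mdifferentiable {g f : ℍ → ℂ} (hg : MDiff g) (hg0 : g ≠ 0)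
    (hf : Continuous f) (h : g * f = 0) : f = 0 := by
  by_contra hf0
  obtain ⟨z₀, hz₀⟩ : ∃ z, f z ≠ 0 := Function.ne_iff.mp hf0
  have hnear : ∀ᶠ z in 𝓝 z₀, g z = 0 := by
    filter_upwards [hf.continuousAt.eventually_ne hz₀] with z hz
    have := congrFun h z
    simp only [Pi.mul_apply, Pi.zero_apply, mul_eq_zero] at this
    tauto
  have hG : AnalyticOnNhd ℂ (g ∘ ofComplex) {z : ℂ | 0 < z.im} :=
    (UpperHalfPlane.mdifferentiable_iff.mp hg).analyticOnNhd isOpen_upperHalfPlaneSet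
  have hGz : (g ∘ ofComplex) =ᶠ[𝓝 (z₀ : ℂ)] 0 := by
    rw [Filter.EventuallyEq, ← UpperHalfPlane.isOpenEmbedding_coe.map_nhds_eq z₀,
      Filter.eventually_map]
    filter_upwards [hnear] with z hz
    simp [ofComplex_apply, hz]
  have hEq := hG.eqOn_zero_of_preconnected_of_eventuallyEq_zero
    (convex_halfSpace_im_gt 0).isPreconnected z₀.im_pos hGz
  apply hg0
  funext z
  simpa [ofComplex_apply] using hEq z.im_pos

/-- `E₄` is not identically zero (it tends to `1` at `i∞`). [folklore] -/
theorem coe_E4_ne_zero : (⇑E₄ : ℍ → ℂ) ≠ 0 := by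
  intro h
  have := tendsto_E4_atImInfty
  rw [h] at this
  exact zero_ne_one (tendsto_nhds_unique tendsto_const_nhds this)

/-- `E₆` is not identically zero (it tends to `1` at `i∞`). [folklore] -/
theorem coe_E6_ne_zero : (⇑E₆ : ℍ → ℂ) ≠ 0 := by
  intro h
  have := tendsto_E6_atImInfty
  rw [h] at this
  exact zero_ne_one (tendsto_nhds_unique tendsto_const_nhds this)

/-- Cancellation of `E₄`. [folklore] -/
theorem E4_mul_left_cancel {f g : ℍ → ℂ} (hf : Continuous f) (hg : Continuous g)
    (h : (⇑E₄ : ℍ → ℂ) * f = ⇑E₄ * g) : f = g := by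
  have : (⇑E₄ : ℍ → ℂ) * (f - g) = 0 := by rw [mul_sub, h, sub_self]
  exact sub_eq_zero.mp (eq_zero_of_mul_eq_zero_of_mdifferentiable E₄.holo' coe_E4_ne_zero
    (hf.sub hg) this)

/-- Cancellation of `E₆`. [folklore] -/
theorem E6_mul_left_cancel {f g : ℍ → ℂ} (hf : Continuous f) (hg : Continuous g)
    (h : (⇑E₆ : ℍ → ℂ) * f = ⇑E₆ * g) : f = g := by
  have : (⇑E₆ : ℍ → ℂ) * (f - g) = 0 := by rw [mul_sub, h, sub_self]
  exact sub_eq_zero.mp (eq_zero_of_mul_eq_zero_of_mdifferentiable E₆.holo' coe_E6_ne_zero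
    (hf.sub hg) this)

variable {Γ : Subgroup (GL (Fin 2) ℝ)} [Γ.HasDetOne] [Γ.IsArithmetic]

/-- **Division lemma** (`E₄, E₆` is a regular sequence on `M(Γ)`): if `E₄ h = E₆ f` with
`h ∈ M_k(Γ)`, `f ∈ M_{k-2}(Γ)` (`Γ ≤ SL₂(ℤ)` arithmetic), then `h = E₆ h'` with `h' ∈ M_{k-6}(Γ)`:
`h' = h/E₆ = f/E₄` is holomorphic because `E₄` and `E₆` have no common zero (`Δ ≠ 0`), and is
bounded at the cusps because `E₆ → 1` at `i∞`. [folklore] -/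
theorem exists_eq_E6_mul_of_E4_mul_eq (hΓ : Γ ≤ 𝒮ℒ) {k : ℤ} {h f : ℍ → ℂ}
    (hh : h ∈ formSpace Γ k) (hf : f ∈ formSpace Γ (k - 2))
    (heq : (⇑E₄ : ℍ → ℂ) * h = ⇑E₆ * f) :
    ∃ h' ∈ formSpace Γ (k - 6), h = ⇑E₆ * h' := by
  classical
  set h' : ℍ → ℂ := fun z ↦ if E₆ z = 0 then f z / E₄ z else h z / E₆ z with hh'
  have hP1 : ∀ z, h' z * E₆ z = h z := by
    intro z
    by_cases h6 : E₆ z = 0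
    · have h4 : E₄ z ≠ 0 := (E4_ne_zero_or_E6_ne_zero z).resolve_right (not_not.mpr h6)
      have := congrFun heq z
      simp only [Pi.mul_apply, h6, zero_mul, mul_eq_zero] at this
      simp [hh', h6, this.resolve_left h4]
    · simp [hh', h6, div_mul_cancel₀ _ h6]
  have hP2 : ∀ z, h' z * E₄ z = f z := by
    intro z
    by_cases h6 : E₆ z = 0
    · have h4 : E₄ z ≠ 0 := (E4_ne_zero_or_E6_ne_zero z).resolve_right (not_not.mpr h6)
      simp [hh', h6, div_mul_cancel₀ _ h4]
    · have := congrFun heq z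
      simp only [Pi.mul_apply] at this
      simp only [hh', h6, if_false]
      rw [div_mul_eq_mul_div, div_eq_iff h6]
      linear_combination this
  have hhol_h := mdifferentiable_of_mem_formSpace hh
  have hhol_f := mdifferentiable_of_mem_formSpace hf
  have hcont4 : Continuous (⇑E₄ : ℍ → ℂ) := E₄.holo'.continuous
  have hcont6 : Continuous (⇑E₆ : ℍ → ℂ) := E₆.holo'.continuous
  -- holomorphy
  have hhol : MDiff h' := by
    intro τ
    by_cases h6 : E₆ τ = 0
    · have h4 : E₄ τ ≠ 0 := (E4_ne_zero_or_E6_ne_zero τ).resolve_right (not_not.mpr h6)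
      have hev : h' =ᶠ[𝓝 τ] fun z ↦ f z / E₄ z := by
        filter_upwards [hcont4.continuousAt.eventually_ne h4] with z hz
        rw [eq_div_iff hz, hP2 z]
      refine MDifferentiableAt.congr_of_eventuallyEq ?_ hev
      rw [UpperHalfPlane.mdifferentiableAt_iff]
      exact ((UpperHalfPlane.mdifferentiableAt_iff.mp (hhol_f τ)).div
        (UpperHalfPlane.mdifferentiableAt_iff.mp (E₄.holo' τ)) (by simpa [ofComplex_apply] using h4))
    · have hev : h' =ᶠ[𝓝 τ] fun z ↦ h z / E₆ z := by
        filter_upwards [hcont6.continuousAt.eventually_ne h6] with z hz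
        rw [eq_div_iff hz, hP1 z]
      refine MDifferentiableAt.congr_of_eventuallyEq ?_ hev
      rw [UpperHalfPlane.mdifferentiableAt_iff]
      exact ((UpperHalfPlane.mdifferentiableAt_iff.mp (hhol_h τ)).div
        (UpperHalfPlane.mdifferentiableAt_iff.mp (E₆.holo' τ)) (by simpa [ofComplex_apply] using h6))
  have hcont : Continuous h' := hhol.continuous
  -- the two product identities as functions
  have hF1 : h' * ⇑E₆ = h := funext hP1
  have hF2 : h' * ⇑E₄ = f := funext hP2
  -- slash by `g ∈ SL₂(ℤ)`
  have hslash6 : ∀ g : SL(2, ℤ), (h' ∣[k - 6] (g : GL (Fin 2) ℝ)) * ⇑E₆ =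
      h ∣[k] (g : GL (Fin 2) ℝ) := by
    intro g
    have := mul_slash_SL2 (k - 6) 6 g h' ⇑E₆
    rw [show k - 6 + 6 = k by ring, hF1,
      show (⇑E₆ ∣[(6 : ℤ)] g) = ⇑E₆ from E₆.slash_action_eq' _ ⟨g, rfl⟩] at this
    simpa [SL_slash] using this.symm
  have hslash4 : ∀ g : SL(2, ℤ), (h' ∣[k - 6] (g : GL (Fin 2) ℝ)) * ⇑E₄ =
      f ∣[k - 2] (g : GL (Fin 2) ℝ) := by
    intro g
    have := mul_slash_SL2 (k - 6) 4 g h' ⇑E₄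
    rw [show k - 6 + 4 = k - 2 by ring, hF2,
      show (⇑E₄ ∣[(4 : ℤ)] g) = ⇑E₄ from E₄.slash_action_eq' _ ⟨g, rfl⟩] at this
    simpa [SL_slash] using this.symm
  refine ⟨h', ?_, by rw [← hF1, mul_comm]⟩
  rw [mem_formSpace_iff]
  refine ⟨hhol, fun γ hγ ↦ ?_, fun g ↦ ?_⟩
  · -- invariance: compare after multiplying by `E₆` and by `E₄`
    obtain ⟨g, rfl⟩ := hΓ hγ
    have hc : Continuous (h' ∣[k - 6] (mapGL ℝ g)) := (hhol.slash _ _).continuous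
    funext z
    have e6 := congrFun (hslash6 g) z
    have e4 := congrFun (hslash4 g) z
    rw [show (mapGL ℝ g : GL (Fin 2) ℝ) = (g : GL (Fin 2) ℝ) from rfl] at *
    rw [slash_eq_of_mem_formSpace hh hγ] at e6
    rw [slash_eq_of_mem_formSpace hf hγ] at e4
    simp only [Pi.mul_apply] at e6 e4
    rw [← hP1 z] at e6
    rw [← hP2 z] at e4
    rcases E4_ne_zero_or_E6_ne_zero z with h4 | h6
    · exact mul_right_cancel₀ h4 e4
    · exact mul_right_cancel₀ h6 e6
  · -- boundedness at `i∞`: `h'|g = (h|g) · E₆⁻¹` eventually, `E₆ → 1`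
    have hev : ∀ᶠ z in atImInfty, (h' ∣[k - 6] (g : GL (Fin 2) ℝ)) z =
        (h ∣[k] (g : GL (Fin 2) ℝ)) z * (E₆ z)⁻¹ := by
      filter_upwards [tendsto_E6_atImInfty.eventually_ne one_ne_zero] with z hz
      rw [← congrFun (hslash6 g) z, Pi.mul_apply, mul_inv_cancel_right₀ hz]
    have h1 : IsBoundedAtImInfty (h ∣[k] (g : GL (Fin 2) ℝ)) :=
      isBoundedAtImInfty_slash_of_mem_formSpace hh g
    have h2 : Tendsto (fun z ↦ (E₆ z)⁻¹) atImInfty (𝓝 1) := by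
      simpa using tendsto_E6_atImInfty.inv₀ one_ne_zero
    have hbd : IsBoundedAtImInfty ((h ∣[k] (g : GL (Fin 2) ℝ)) * fun z ↦ (E₆ z)⁻¹) :=
      h1.mul (h2.isBigO_one ℝ)
    refine hbd.congr' ?_ EventuallyEq.rfl
    filter_upwards [hev] with z hz
    simp [hz]

end Division

/-! ### `M(Γ₀(N))` as a module over `M(SL₂(ℤ))`: generators -/

section Gamma0

variable (N : ℕ) [NeZero N]

/-- The form space `A_k = M_k(Γ₀(N))`. [folklore] -/
abbrev gamma0Space (k : ℤ) : Submodule ℂ (ℍ → ℂ) := formSpace (Gamma0 N) k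

omit [NeZero N] in
/-- `Γ₀(N) ≤ SL₂(ℤ)` inside `GL(2, ℝ)`. [folklore] -/
theorem gamma0_le_SL : ((Gamma0 N : Subgroup SL(2, ℤ)) : Subgroup (GL (Fin 2) ℝ)) ≤ 𝒮ℒ := by
  rintro _ ⟨g, -, rfl⟩
  exact ⟨g, rfl⟩

/-- `A_k` is finite-dimensional (Sturm). [folklore] -/
instance finiteDimensional_gamma0Space (k : ℤ) : FiniteDimensional ℂ (gamma0Space N k) :=
  haveI := (finiteDimensional_modularForm_gamma0 N k).1
  finiteDimensional_formSpace

/-- `dim A_k ≤ ⌊kμ/12⌋ + 1` (Sturm, tree `finiteDimensional_modularForm_gamma0`). [folklore] -/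
theorem finrank_gamma0Space_le (k : ℤ) :
    Module.finrank ℂ (gamma0Space N k) ≤ (k * gamma0Index N).toNat / 12 + 1 := by
  rw [finrank_formSpace]
  exact (finiteDimensional_modularForm_gamma0 N k).2

/-- `R_w · A_k ⊆ A_{w+k}`. [folklore] -/
theorem levelOne_mul_mem {w k : ℤ} {p f : ℍ → ℂ} (hp : p ∈ levelOneSpace w)
    (hf : f ∈ gamma0Space N k) : p * f ∈ gamma0Space N (w + k) :=
  mul_mem_formSpace (formSpace_mono (gamma0_le_SL N) hp) hf

omit [NeZero N] in
/-- `A_k = 0` for odd `k` (`-1 ∈ Γ₀(N)`). [folklore] -/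
theorem gamma0Space_eq_bot_of_odd {k : ℤ} (hk : Odd k) : gamma0Space N k = ⊥ :=
  formSpace_eq_bot_of_odd ⟨-1, by simp, by ext; simp⟩ hk

/-- The decomposable part `E₄ A_{k-4} + E₆ A_{k-6} ⊆ A_k`. [folklore] -/
def decomp (k : ℤ) : Submodule ℂ (ℍ → ℂ) :=
  (gamma0Space N (k - 4)).map (LinearMap.mulLeft ℂ (⇑E₄ : ℍ → ℂ)) ⊔
    (gamma0Space N (k - 6)).map (LinearMap.mulLeft ℂ (⇑E₆ : ℍ → ℂ))

omit [NeZero N] in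
/-- Membership in `decomp`. [folklore] -/
theorem mem_decomp_iff {k : ℤ} {f : ℍ → ℂ} : f ∈ decomp N k ↔
    ∃ g ∈ gamma0Space N (k - 4), ∃ h ∈ gamma0Space N (k - 6), f = ⇑E₄ * g + ⇑E₆ * h := by
  simp only [decomp, Submodule.mem_sup, Submodule.mem_map, LinearMap.mulLeft_apply]
  constructor
  · rintro ⟨_, ⟨g, hg, rfl⟩, _, ⟨h, hh, rfl⟩, rfl⟩
    exact ⟨g, hg, h, hh, rfl⟩
  · rintro ⟨g, hg, h, hh, rfl⟩
    exact ⟨_, ⟨g, hg, rfl⟩, _, ⟨h, hh, rfl⟩, rfl⟩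

/-- `decomp N k ≤ A_k`. [folklore] -/
theorem decomp_le (k : ℤ) : decomp N k ≤ gamma0Space N k := by
  intro f hf
  obtain ⟨g, hg, h, hh, rfl⟩ := (mem_decomp_iff N).mp hf
  refine Submodule.add_mem _ ?_ ?_
  · simpa using levelOne_mul_mem N E4_mem hg
  · simpa using levelOne_mul_mem N E6_mem hh

/-- **Generators in weight `k`**: a linearly independent finite family in `A_k` spanning a
complement of `E₄ A_{k-4} + E₆ A_{k-6}` (a lift of a basis of `A_k / (E₄, E₆)A`). [folklore] -/
theorem exists_generators (k : ℤ) : ∃ (n : ℕ) (b : Fin n → (ℍ → ℂ)),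
    (∀ i, b i ∈ gamma0Space N k) ∧ LinearIndependent ℂ b ∧
    Disjoint (Submodule.span ℂ (Set.range b)) (decomp N k) ∧
    gamma0Space N k ≤ decomp N k ⊔ Submodule.span ℂ (Set.range b) := by
  obtain ⟨Q₀, hQ₀⟩ := (decomp N k).exists_isCompl
  -- the complement inside `A_k`
  let Q : Submodule ℂ (ℍ → ℂ) := Q₀ ⊓ gamma0Space N k
  haveI : FiniteDimensional ℂ Q := Submodule.finiteDimensional_inf_right _ _
  let b₀ : Module.Basis (Fin (Module.finrank ℂ Q)) ℂ Q := Module.finBasis ℂ Q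
  have hspan : Submodule.span ℂ (Set.range (Q.subtype ∘ b₀)) = Q := by
    rw [Set.range_comp, ← Submodule.map_span, b₀.span_eq, Submodule.map_top, Submodule.range_subtype]
  refine ⟨_, Q.subtype ∘ b₀, fun i ↦ (b₀ i).2.2, ?_, ?_, ?_⟩
  · exact b₀.linearIndependent.map' Q.subtype (Submodule.ker_subtype Q)
  · rw [hspan]
    exact (hQ₀.symm.disjoint).mono_left inf_le_left
  · intro v hv
    have htop : v ∈ decomp N k ⊔ Q₀ := by
      rw [hQ₀.sup_eq_top]
      trivial
    obtain ⟨d, hd, q, hq, rfl⟩ := Submodule.mem_sup.mp htop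
    have hqV : q ∈ gamma0Space N k := by
      have : d + q - d ∈ gamma0Space N k := Submodule.sub_mem _ hv (decomp_le N k hd)
      simpa using this
    rw [hspan]
    exact Submodule.add_mem_sup hd ⟨hq, hqV⟩

/-- The number of generators of weight `k` (for `k : ℕ`). [folklore] -/
def numGen (k : ℕ) : ℕ := Classical.choose (exists_generators N k)

/-- The generators of weight `k`. [folklore] -/
def gen (k : ℕ) : Fin (numGen N k) → (ℍ → ℂ) :=
  Classical.choose (Classical.choose_spec (exists_generators N k))

/-- Specification of the generators. [folklore] -/
theorem gen_spec (k : ℕ) :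
    (∀ i, gen N k i ∈ gamma0Space N k) ∧ LinearIndependent ℂ (gen N k) ∧
    Disjoint (Submodule.span ℂ (Set.range (gen N k))) (decomp N k) ∧
    gamma0Space N k ≤ decomp N k ⊔ Submodule.span ℂ (Set.range (gen N k)) :=
  Classical.choose_spec (Classical.choose_spec (exists_generators N k))

/-- The index type of all generators: pairs (weight, index). [folklore] -/
abbrev GenIndex : Type := Σ k : ℕ, Fin (numGen N k)

/-- The weight of a generator. [folklore] -/
def GenIndex.wt (j : GenIndex N) : ℤ := (j.1 : ℤ)

/-- The generator as a function. [folklore] -/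
def GenIndex.fn (j : GenIndex N) : ℍ → ℂ := gen N j.1 j.2

/-- The (finite) set of generators of weight `≤ m`. [folklore] -/
def genBelow (m : ℕ) : Finset (GenIndex N) :=
  (Finset.range (m + 1)).sigma fun _ ↦ Finset.univ

/-- Membership in `genBelow`. [folklore] -/
@[simp] theorem mem_genBelow {m : ℕ} {j : GenIndex N} : j ∈ genBelow N m ↔ j.1 ≤ m := by
  simp [genBelow]

/-- Monotonicity of `genBelow`. [folklore] -/
theorem genBelow_mono {m m' : ℕ} (h : m ≤ m') : genBelow N m ⊆ genBelow N m' := fun j hj ↦ by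
  rw [mem_genBelow] at hj ⊢
  omega

/-- A generator lies in its form space. [folklore] -/
theorem GenIndex.fn_mem (j : GenIndex N) : j.fn ∈ gamma0Space N j.wt := (gen_spec N j.1).1 j.2

/-- Weights of generators are nonnegative. [folklore] -/
theorem GenIndex.wt_nonneg (j : GenIndex N) : 0 ≤ j.wt := Int.natCast_nonneg _

/-- Coefficients of negative weight vanish: if `p ∈ R_{m - wt j}` and `m < wt j` then `p = 0`.
[folklore] -/
theorem coeff_eq_zero_of_lt {m : ℤ} {j : GenIndex N} {p : ℍ → ℂ}
    (hp : p ∈ levelOneSpace (m - j.wt)) (h : m < j.wt) : p = 0 := by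
  have : levelOneSpace (m - j.wt) = ⊥ := formSpace_eq_bot_of_neg (by omega)
  rw [this] at hp
  exact hp

/-- Sums `∑ p_j F_j` with `p_j ∈ R_{m - k_j}` lie in `A_m`. [folklore] -/
theorem sum_mul_fn_mem {m : ℤ} (s : Finset (GenIndex N)) {p : GenIndex N → ℍ → ℂ}
    (hp : ∀ j, p j ∈ levelOneSpace (m - j.wt)) : ∑ j ∈ s, p j * j.fn ∈ gamma0Space N m := by
  refine Submodule.sum_mem _ fun j _ ↦ ?_
  have := levelOne_mul_mem N (hp j) (GenIndex.fn_mem N j)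
  rwa [sub_add_cancel] at this

/-- **Transport of sums**: if `p_j ∈ R_{m - k_j}` then the sum over generators of weight `≤ m'`
equals the sum over generators of weight `≤ m.toNat` for any `m' ≥ m.toNat` (the extra terms
vanish). [folklore] -/
theorem sum_genBelow_eq {m : ℤ} {m' : ℕ} (hm : m.toNat ≤ m') {p : GenIndex N → ℍ → ℂ}
    (hp : ∀ j, p j ∈ levelOneSpace (m - j.wt)) :
    ∑ j ∈ genBelow N m', p j * j.fn = ∑ j ∈ genBelow N m.toNat, p j * j.fn := by
  symm
  apply Finset.sum_subset (genBelow_mono N hm)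
  intro j hj hj'
  rw [mem_genBelow] at hj hj'
  have : m < j.wt := by
    simp only [GenIndex.wt]
    omega
  rw [coeff_eq_zero_of_lt N (hp j) this, zero_mul]

/-- **Spanning**: every `f ∈ A_m` is `∑_j p_j F_j` over the generators of weight `≤ m`, with
level-one coefficients `p_j ∈ R_{m - k_j}` (induction on the weight, using
`A_k ⊆ E₄A_{k-4} + E₆A_{k-6} + ⟨generators of weight k⟩`). [folklore] -/
theorem exists_coeffs (m : ℤ) {f : ℍ → ℂ} (hf : f ∈ gamma0Space N m) :
    ∃ p : GenIndex N → ℍ → ℂ, (∀ j, p j ∈ levelOneSpace (m - j.wt)) ∧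
      f = ∑ j ∈ genBelow N m.toNat, p j * j.fn := by
  induction' hn : m.toNat using Nat.strong_induction_on with n ih generalizing m f
  rcases lt_or_ge m 0 with hneg | hnonneg
  · have hf0 : f = 0 := by
      have : gamma0Space N m = ⊥ := formSpace_eq_bot_of_neg hneg
      rw [this] at hf
      exact hf
    exact ⟨0, fun j ↦ Submodule.zero_mem _, by simp [hf0]⟩
  obtain rfl : m = n := by omega
  -- the induction hypothesis for all integer weights `< n` (trivial below `0`)
  have ih' : ∀ m' : ℤ, m' < n → ∀ {f : ℍ → ℂ}, f ∈ gamma0Space N m' →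
      ∃ p : GenIndex N → ℍ → ℂ, (∀ j, p j ∈ levelOneSpace (m' - j.wt)) ∧
        f = ∑ j ∈ genBelow N m'.toNat, p j * j.fn := by
    intro m' hm' f hf
    rcases lt_or_ge m' 0 with hneg | hnn
    · have hf0 : f = 0 := by
        have : gamma0Space N m' = ⊥ := formSpace_eq_bot_of_neg hneg
        rw [this] at hf
        exact hf
      exact ⟨0, fun j ↦ Submodule.zero_mem _, by simp [hf0]⟩
    · exact ih m'.toNat (by omega) m' hf rfl
  -- decompose `f` in weight `n`
  obtain ⟨hmem, -, -, hle⟩ := gen_spec N n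
  obtain ⟨d, hd, v, hv, rfl⟩ := Submodule.mem_sup.mp (hle hf)
  obtain ⟨g, hg, h, hh, rfl⟩ := (mem_decomp_iff N).mp hd
  obtain ⟨c, rfl⟩ := (Finsupp.mem_span_range_iff_exists_finsupp.mp hv)
  -- induction hypotheses for `g` and `h`
  obtain ⟨pg, hpg, hgsum⟩ := ih' ((n : ℤ) - 4) (by omega) hg
  obtain ⟨ph, hph, hhsum⟩ := ih' ((n : ℤ) - 6) (by omega) hh
  classical
  refine ⟨fun j ↦ ⇑E₄ * pg j + ⇑E₆ * ph j +
      (if hj : j.1 = n then c (Fin.cast (by rw [hj]) j.2) else 0) • 1, fun j ↦ ?_, ?_⟩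
  · refine Submodule.add_mem _ (Submodule.add_mem _ ?_ ?_) ?_
    · have := mul_mem_formSpace E4_mem (hpg j)
      rwa [show (4 : ℤ) + ((n : ℤ) - 4 - j.wt) = n - j.wt by ring] at this
    · have := mul_mem_formSpace E6_mem (hph j)
      rwa [show (6 : ℤ) + ((n : ℤ) - 6 - j.wt) = n - j.wt by ring] at this
    · split_ifs with hj
      · have h0 : (n : ℤ) - j.wt = 0 := by simp [GenIndex.wt, hj]
        rw [h0]
        exact Submodule.smul_mem _ _ ⟨1, ModularForm.one_coe_eq_one⟩
      · simp
  · simp only [add_mul, Finset.sum_add_distrib]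
    have e1 : ∑ j ∈ genBelow N n, ⇑E₄ * pg j * j.fn = ⇑E₄ * g := by
      rw [hgsum, ← sum_genBelow_eq N (m := (n : ℤ) - 4) (m' := n) (by omega) hpg, Finset.mul_sum]
      simp only [mul_assoc]
    have e2 : ∑ j ∈ genBelow N n, ⇑E₆ * ph j * j.fn = ⇑E₆ * h := by
      rw [hhsum, ← sum_genBelow_eq N (m := (n : ℤ) - 6) (m' := n) (by omega) hph, Finset.mul_sum]
      simp only [mul_assoc]
    rw [e1, e2]
    congr 1
    -- the generator part
    rw [genBelow, Finset.sum_sigma, Finset.sum_eq_single_of_mem n (by simp) (fun k _ hk ↦ ?_)]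
    · simp only [Fin.cast_eq_self, Finsupp.sum]
      rw [Finset.sum_subset (Finset.subset_univ c.support) (fun i _ hi ↦ by
        simp [Finsupp.notMem_support_iff.mp hi])]
      refine Finset.sum_congr rfl fun i _ ↦ ?_
      simp [GenIndex.fn, Pi.smul_def, smul_eq_mul]
      rfl
    · exact Finset.sum_eq_zero fun i _ ↦ by simp [hk]

/-- The generators of weight `n` are linearly independent over `ℂ`, in the form needed below:
a vanishing combination `∑_{j, wt j ≤ n} c_j F_j = 0` supported on `wt j = n` has `c = 0`.
[folklore] -/
theorem consts_eq_zero (n : ℕ) {c : GenIndex N → ℂ} (hc : ∀ j, j.1 ≠ n → c j = 0)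
    (h0 : ∑ j ∈ genBelow N n, c j • j.fn = 0) : ∀ j, c j = 0 := by
  have hsum : ∑ j ∈ genBelow N n, c j • j.fn = ∑ i : Fin (numGen N n), c ⟨n, i⟩ • gen N n i := by
    rw [genBelow, Finset.sum_sigma, Finset.sum_eq_single_of_mem n (by simp) (fun k _ hk ↦ ?_)]
    · rfl
    · exact Finset.sum_eq_zero fun i _ ↦ by simp [hc ⟨k, i⟩ hk]
  rw [hsum] at h0
  have hli := (gen_spec N n).2.1
  have := Fintype.linearIndependent_iff.mp hli (fun i ↦ c ⟨n, i⟩) h0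
  intro j
  by_cases hj : j.1 = n
  · obtain ⟨k, i⟩ := j
    subst hj
    exact this i
  · exact hc j hj

/-- **Independence over `M(SL₂(ℤ))`**: a relation `∑_j p_j F_j = 0` with level-one coefficients
`p_j ∈ R_{m - k_j}` is trivial. Proof (graded Nakayama by hand): write `p_j = E₄a_j + E₆b_j + c_j`
(`c_j` constants, present only for `k_j = m`); the constants vanish because the generators of
weight `m` span a complement of `E₄A_{m-4} + E₆A_{m-6}`; then `E₄X = -E₆Y` with
`X = ∑ a_jF_j`, `Y = ∑ b_jF_j`, so `X = E₆G` by the division lemma, and expanding `G` in the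
generators (spanning in weight `m - 10`) the induction hypothesis in weights `m - 4` and `m - 6`
gives `a_j = E₆q_j`, `b_j = -E₄q_j`, whence `p_j = 0`. [folklore] -/
theorem coeffs_eq_zero (m : ℤ) (p : GenIndex N → ℍ → ℂ)
    (hp : ∀ j, p j ∈ levelOneSpace (m - j.wt))
    (h0 : ∑ j ∈ genBelow N m.toNat, p j * j.fn = 0) : ∀ j, p j = 0 := by
  induction' hn : m.toNat using Nat.strong_induction_on with n ih generalizing m p
  -- negative weight: all coefficients vanish for weight reasons
  have hnegcase : ∀ (m' : ℤ), m' < 0 → ∀ (p' : GenIndex N → ℍ → ℂ),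
      (∀ j, p' j ∈ levelOneSpace (m' - j.wt)) → ∀ j, p' j = 0 := fun m' hm' p' hp' j ↦
    coeff_eq_zero_of_lt N (hp' j) (lt_of_lt_of_le hm' (GenIndex.wt_nonneg N j))
  rcases lt_or_ge m 0 with hneg | hnonneg
  · exact hnegcase m hneg p hp
  obtain rfl : m = n := by omega
  have ih' : ∀ m' : ℤ, m' < n → ∀ (p' : GenIndex N → ℍ → ℂ),
      (∀ j, p' j ∈ levelOneSpace (m' - j.wt)) →
      ∑ j ∈ genBelow N m'.toNat, p' j * j.fn = 0 → ∀ j, p' j = 0 := by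
    intro m' hm' p' hp' h0'
    rcases lt_or_ge m' 0 with hneg | hnn
    · exact hnegcase m' hneg p' hp'
    · exact ih m'.toNat (by omega) m' p' hp' h0' rfl
  -- Step 1: decompose the coefficients
  have hdec : ∀ j : GenIndex N, ∃ a b : ℍ → ℂ, ∃ c : ℂ,
      a ∈ levelOneSpace ((n : ℤ) - 4 - j.wt) ∧ b ∈ levelOneSpace ((n : ℤ) - 6 - j.wt) ∧
      (j.1 ≠ n → c = 0) ∧ p j = ⇑E₄ * a + ⇑E₆ * b + c • 1 := by
    intro j
    rcases lt_trichotomy (j.1 : ℤ) n with hlt | heq | hgt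
    · have hw : (n : ℤ) - j.wt ≠ 0 := by simp only [GenIndex.wt]; omega
      obtain ⟨_, ⟨a, ha, rfl⟩, _, ⟨b, hb, rfl⟩, hab⟩ :=
        Submodule.mem_sup.mp (levelOneSpace_le_sup hw (hp j))
      refine ⟨a, b, 0, ?_, ?_, fun _ ↦ rfl, ?_⟩
      · rwa [show (n : ℤ) - j.wt - 4 = n - 4 - j.wt by ring] at ha
      · rwa [show (n : ℤ) - j.wt - 6 = n - 6 - j.wt by ring] at hb
      · rw [← hab]
        simp [LinearMap.mulLeft_apply]
    · have h0w : (n : ℤ) - j.wt = 0 := by simp only [GenIndex.wt]; omega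
      have hpj := hp j
      rw [h0w] at hpj
      obtain ⟨F, hF⟩ := hpj
      obtain ⟨c, hc⟩ := ModularForm.eq_const_of_weight_zero F
      refine ⟨0, 0, c, Submodule.zero_mem _, Submodule.zero_mem _, fun h ↦ ?_, ?_⟩
      · exact absurd (by exact_mod_cast heq) h
      · rw [← hF, hc]
        funext z
        simp
    · have : p j = 0 := coeff_eq_zero_of_lt N (hp j) (by simp only [GenIndex.wt]; omega)
      exact ⟨0, 0, 0, Submodule.zero_mem _, Submodule.zero_mem _, fun _ ↦ rfl, by simp [this]⟩
  choose a b c ha hb hc hpabc using hdec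
  -- Step 2: the constants vanish
  set X : ℍ → ℂ := ∑ j ∈ genBelow N n, a j * j.fn with hX
  set Y : ℍ → ℂ := ∑ j ∈ genBelow N n, b j * j.fn with hY
  set Z : ℍ → ℂ := ∑ j ∈ genBelow N n, c j • j.fn with hZ
  have hXmem : X ∈ gamma0Space N ((n : ℤ) - 4) := sum_mul_fn_mem N _ ha
  have hYmem : Y ∈ gamma0Space N ((n : ℤ) - 6) := sum_mul_fn_mem N _ hb
  have hrel : ⇑E₄ * X + ⇑E₆ * Y + Z = 0 := by
    rw [← h0, Int.toNat_natCast, hX, hY, hZ, Finset.mul_sum, Finset.mul_sum,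
      ← Finset.sum_add_distrib, ← Finset.sum_add_distrib]
    refine Finset.sum_congr rfl fun j _ ↦ ?_
    rw [hpabc j]
    simp only [add_mul, mul_assoc, smul_one_mul]
  have hZspan : Z ∈ Submodule.span ℂ (Set.range (gen N n)) := by
    refine Submodule.sum_mem _ fun j _ ↦ ?_
    by_cases hj : j.1 = n
    · refine Submodule.smul_mem _ _ (Submodule.subset_span ?_)
      obtain ⟨k, i⟩ := j
      subst hj
      exact ⟨i, rfl⟩
    · simp [hc j hj]
  have hZdec : Z ∈ decomp N n := by
    have : Z = -(⇑E₄ * X + ⇑E₆ * Y) := by rw [← add_eq_zero_iff_eq_neg', hrel]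
    rw [this]
    exact Submodule.neg_mem _ ((mem_decomp_iff N).mpr ⟨X, hXmem, Y, hYmem, rfl⟩)
  have hZ0 : Z = 0 := Submodule.disjoint_def.mp (gen_spec N n).2.2.1 Z hZspan hZdec
  have hc0 : ∀ j, c j = 0 := consts_eq_zero N n hc (hZ ▸ hZ0)
  -- Step 3: `E₄ X = E₆ (-Y)`, divide
  have hrel' : ⇑E₄ * X = ⇑E₆ * (-Y) := by
    rw [hZ0, add_zero] at hrel
    rw [mul_neg, ← add_eq_zero_iff_eq_neg, hrel]
  obtain ⟨G, hG, hXG⟩ := exists_eq_E6_mul_of_E4_mul_eq (gamma0_le_SL N) hXmem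
    (by rw [show (n : ℤ) - 4 - 2 = n - 6 by ring]; exact Submodule.neg_mem _ hYmem) hrel'
  rw [show (n : ℤ) - 4 - 6 = n - 10 by ring] at hG
  obtain ⟨q, hq, hGsum⟩ := exists_coeffs N ((n : ℤ) - 10) hG
  have hGsum' : G = ∑ j ∈ genBelow N n, q j * j.fn := by
    rw [hGsum, sum_genBelow_eq N (m := (n : ℤ) - 10) (m' := n) (by omega) hq]
  -- relation in weight `n - 4`: `a_j = E₆ q_j`
  have haq : ∀ j, a j = ⇑E₆ * q j := by
    have hcoef : ∀ j, a j - ⇑E₆ * q j ∈ levelOneSpace ((n : ℤ) - 4 - j.wt) := fun j ↦ by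
      refine Submodule.sub_mem _ (ha j) ?_
      have := mul_mem_formSpace E6_mem (hq j)
      rwa [show (6 : ℤ) + ((n : ℤ) - 10 - j.wt) = n - 4 - j.wt by ring] at this
    have hsum0 : ∑ j ∈ genBelow N ((n : ℤ) - 4).toNat, (a j - ⇑E₆ * q j) * j.fn = 0 := by
      rw [← sum_genBelow_eq N (m := (n : ℤ) - 4) (m' := n) (by omega) hcoef]
      simp only [sub_mul, Finset.sum_sub_distrib, mul_assoc, ← Finset.mul_sum]
      rw [← hGsum', ← hX, hXG, sub_self]
    intro j
    exact sub_eq_zero.mp (ih' ((n : ℤ) - 4) (by omega) _ hcoef hsum0 j)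
  -- Step 4: `E₄ G + Y = 0`, relation in weight `n - 6`: `b_j = -E₄ q_j`
  have hE4GY : ⇑E₄ * G + Y = 0 := by
    have h1 : ⇑E₆ * (⇑E₄ * G + Y) = ⇑E₆ * 0 := by
      rw [mul_zero, mul_add, ← mul_assoc, mul_comm (⇑E₆) (⇑E₄), mul_assoc, ← hXG]
      rw [hZ0, add_zero] at hrel
      exact hrel
    have hGmem : G ∈ gamma0Space N ((n : ℤ) - 10) := hG
    refine E6_mul_left_cancel ?_ continuous_const h1
    exact ((mdifferentiable_of_mem_formSpace (levelOne_mul_mem N E4_mem hGmem)).continuous).add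
      (mdifferentiable_of_mem_formSpace hYmem).continuous
  have hbq : ∀ j, b j = -(⇑E₄ * q j) := by
    have hcoef : ∀ j, ⇑E₄ * q j + b j ∈ levelOneSpace ((n : ℤ) - 6 - j.wt) := fun j ↦ by
      refine Submodule.add_mem _ ?_ (hb j)
      have := mul_mem_formSpace E4_mem (hq j)
      rwa [show (4 : ℤ) + ((n : ℤ) - 10 - j.wt) = n - 6 - j.wt by ring] at this
    have hsum0 : ∑ j ∈ genBelow N ((n : ℤ) - 6).toNat, (⇑E₄ * q j + b j) * j.fn = 0 := by
      rw [← sum_genBelow_eq N (m := (n : ℤ) - 6) (m' := n) (by omega) hcoef]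
      simp only [add_mul, Finset.sum_add_distrib, mul_assoc, ← Finset.mul_sum]
      rw [← hGsum', ← hY, hE4GY]
    intro j
    exact eq_neg_of_add_eq_zero_right (ih' ((n : ℤ) - 6) (by omega) _ hcoef hsum0 j)
  -- Step 5
  intro j
  rw [hpabc j, haq j, hbq j, hc0 j]
  simp only [zero_smul, add_zero]
  ring

/-! ### Counting: at most `μ` generators -/

omit [NeZero N] in
/-- `R_w` is finite-dimensional (Mathlib). [folklore] -/
instance finiteDimensional_levelOneSpace (w : ℤ) : FiniteDimensional ℂ (levelOneSpace w) :=
  finiteDimensional_formSpace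

omit [NeZero N] in
/-- `dim R_w ≥ ⌊w/12⌋` for even `w` (Mathlib's level-one dimension formula). [folklore] -/
theorem le_finrank_levelOneSpace {w : ℕ} (hw : Even w) :
    w / 12 ≤ Module.finrank ℂ (levelOneSpace w) := by
  rw [finrank_formSpace]
  have h := ModularForm.dimension_level_one w hw
  have : Module.finrank ℂ (ModularForm 𝒮ℒ w) =
      if w ≡ 2 [MOD 12] then w / 12 else w / 12 + 1 := by
    apply Module.finrank_eq_of_rank_eq
    rw [h]
  rw [this]
  split_ifs <;> omega

/-- There are no generators in odd weight (`A_k = 0`). [folklore] -/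
theorem numGen_eq_zero_of_odd {k : ℕ} (hk : Odd k) : numGen N k = 0 := by
  by_contra h
  have hli := (gen_spec N k).2.1
  have hmem := (gen_spec N k).1 ⟨0, Nat.pos_of_ne_zero h⟩
  rw [gamma0Space_eq_bot_of_odd N (by exact_mod_cast hk), Submodule.mem_bot] at hmem
  exact hli.ne_zero ⟨0, Nat.pos_of_ne_zero h⟩ hmem

/-- Weights of generators are even. [folklore] -/
theorem GenIndex.even_fst (j : GenIndex N) : Even j.1 := by
  by_contra h
  rw [Nat.not_even_iff_odd] at h
  have := numGen_eq_zero_of_odd N h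
  exact (Nat.pos_iff_ne_zero.mp (this ▸ j.2.pos : 0 < 0)).elim rfl |>.elim

/-- **The key inequality**: for all `B, L`, `#(generators of weight ≤ B) · L ≤ Lμ + Bμ + 1`, from
the injection `⊕_{j} R_{M - k_j} ↪ A_M` (`M = 12L + 2B`, independence) and Sturm's bound
`dim A_M ≤ Mμ/12 + 1` against `dim R_w ≥ ⌊w/12⌋`. [folklore] -/
theorem card_genBelow_mul_le (B L : ℕ) :
    (genBelow N B).card * L ≤ L * gamma0Index N + B * gamma0Index N + 1 := by
  classical
  set M : ℕ := 12 * L + 2 * B with hM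
  set s := genBelow N B with hs
  -- the combination map
  let Ψ : (Π j : s, levelOneSpace ((M : ℤ) - (j : GenIndex N).wt)) →ₗ[ℂ] (ℍ → ℂ) :=
    { toFun := fun p ↦ ∑ j : s, ((p j : ℍ → ℂ)) * (j : GenIndex N).fn
      map_add' := fun p p' ↦ by
        simp only [Pi.add_apply, Submodule.coe_add, add_mul, Finset.sum_add_distrib]
      map_smul' := fun c p ↦ by
        simp only [Pi.smul_apply, Submodule.coe_smul, RingHom.id_apply, Finset.smul_sum,
          smul_mul_assoc] }
  have hΨmem : ∀ p, Ψ p ∈ gamma0Space N M := fun p ↦ by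
    refine Submodule.sum_mem _ fun j _ ↦ ?_
    have := levelOne_mul_mem N (p j).2 (GenIndex.fn_mem N (j : GenIndex N))
    rwa [sub_add_cancel] at this
  have hΨinj : Function.Injective (Ψ.codRestrict _ hΨmem) := by
    rw [injective_iff_map_eq_zero]
    intro p hp0
    have hsum0 : ∑ j : s, ((p j : ℍ → ℂ)) * (j : GenIndex N).fn = 0 :=
      congrArg Subtype.val hp0
    -- extend `p` by zero
    let P : GenIndex N → ℍ → ℂ := fun j ↦ if h : j ∈ s then (p ⟨j, h⟩ : ℍ → ℂ) else 0
    have hP : ∀ j, P j ∈ levelOneSpace ((M : ℤ) - j.wt) := fun j ↦ by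
      by_cases h : j ∈ s
      · simp only [P, h, dif_pos]
        exact (p ⟨j, h⟩).2
      · simp only [P, h, dif_neg, not_false_eq_true]
        exact Submodule.zero_mem _
    have hPsum : ∑ j ∈ genBelow N (M : ℤ).toNat, P j * j.fn = 0 := by
      rw [Int.toNat_natCast, ← Finset.sum_subset (genBelow_mono N (show B ≤ M by omega))
        (fun j _ hj ↦ by
          have : ¬ j.1 ≤ B := fun h ↦ hj ((mem_genBelow N).mpr h)
          simp [P, hs, this])]
      rw [← hsum0, ← Finset.sum_coe_sort s]
      refine Finset.sum_congr rfl fun j _ ↦ ?_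
      simp [P, j.2]
    have hP0 := coeffs_eq_zero N (M : ℤ) P hP hPsum
    funext j
    apply Subtype.ext
    have := hP0 j
    simp only [P, j.2, dif_pos] at this
    simpa using this
  -- dimension count
  have hdom : s.card * L ≤ Module.finrank ℂ (Π j : s, levelOneSpace ((M : ℤ) - (j : GenIndex N).wt)) := by
    have hcard : s.card * L = ∑ _i : s, L := by
      simp [Finset.sum_const]
    rw [Module.finrank_pi_fintype, hcard]
    refine Finset.sum_le_sum fun j _ ↦ ?_
    have hjB : (j : GenIndex N).1 ≤ B := (mem_genBelow N).mp j.2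
    obtain ⟨r, hr⟩ := GenIndex.even_fst N j
    have hw : ((M : ℤ) - (j : GenIndex N).wt) = ((M - (j : GenIndex N).1 : ℕ) : ℤ) := by
      simp only [GenIndex.wt]
      omega
    rw [hw]
    refine le_trans ?_ (le_finrank_levelOneSpace ⟨6 * L + B - r, by omega⟩)
    omega
  have hcod : Module.finrank ℂ (gamma0Space N M) ≤ L * gamma0Index N + B * gamma0Index N + 1 := by
    refine (finrank_gamma0Space_le N M).trans ?_
    have : ((M : ℤ) * gamma0Index N).toNat = M * gamma0Index N := by
      rw [show ((M : ℤ) * gamma0Index N) = ((M * gamma0Index N : ℕ) : ℤ) by push_cast; ring]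
      exact Int.toNat_natCast _
    rw [this, hM]
    have h1 : (12 * L + 2 * B) * gamma0Index N / 12 ≤ L * gamma0Index N + B * gamma0Index N := by
      apply Nat.div_le_of_le_mul
      nlinarith
    omega
  exact hdom.trans ((LinearMap.finrank_le_finrank_of_injective hΨinj).trans hcod)

/-- **At most `μ = [SL₂(ℤ) : Γ₀(N)]` generators** of weight `≤ B`, for every `B`. [folklore] -/
theorem card_genBelow_le (B : ℕ) : (genBelow N B).card ≤ gamma0Index N := by
  by_contra h
  push Not at h
  have key := card_genBelow_mul_le N B (B * gamma0Index N + 2)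
  set μ := gamma0Index N
  set L := B * μ + 2 with hL
  have h1 : (μ + 1) * L ≤ L * μ + B * μ + 1 := (Nat.mul_le_mul_right L h).trans key
  rw [Nat.succ_mul, mul_comm L μ] at h1
  omega

/-- The generators have bounded weight: there are finitely many. [folklore] -/
theorem exists_fst_le : ∃ K₀ : ℕ, ∀ j : GenIndex N, j.1 ≤ K₀ := by
  classical
  set S : Set ℕ := {k | numGen N k ≠ 0} with hS
  have hSfin : S.Finite := by
    by_contra hinf
    obtain ⟨T, hTS, hTcard⟩ := Set.Infinite.exists_subset_card_eq hinf (gamma0Index N + 1)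
    set B := T.sup id
    have h1 : T.card ≤ ∑ k ∈ T, numGen N k := by
      rw [Finset.card_eq_sum_ones]
      exact Finset.sum_le_sum fun k hk ↦ Nat.one_le_iff_ne_zero.mpr (hTS hk)
    have h2 : ∑ k ∈ T, numGen N k ≤ (genBelow N B).card := by
      rw [genBelow, Finset.card_sigma]
      simp only [Finset.card_univ, Fintype.card_fin]
      refine Finset.sum_le_sum_of_subset fun k hk ↦ ?_
      exact Finset.mem_range.mpr (Nat.lt_succ_of_le (Finset.le_sup (f := id) hk))
    have h3 := card_genBelow_le N B
    omega
  refine ⟨hSfin.toFinset.sup id, fun j ↦ ?_⟩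
  have hj : j.1 ∈ hSfin.toFinset := by
    rw [Set.Finite.mem_toFinset]
    exact Nat.pos_iff_ne_zero.mp j.2.pos
  exact Finset.le_sup (f := id) hj

/-! ### The free basis -/

/-- **A level-one basis of `M(Γ₀(N))`**: a finite family `F_i ∈ M_{k_i}(Γ₀(N))` such that every
`f ∈ M_m(Γ₀(N))` is uniquely `∑_i p_i F_i` with `p_i ∈ M_{m - k_i}(SL₂(ℤ))`; i.e. `(F_i)` is a
basis of the `M(SL₂(ℤ)) = ℂ[E₄,E₆]`-module `M(Γ₀(N)) = ⊕_m M_m(Γ₀(N))`, homogeneous of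
weights `k_i`. [cite: Gannon2014, Thm. 3.4] -/
structure IsLevelOneBasis {r : ℕ} (wt : Fin r → ℤ) (F : Fin r → ℍ → ℂ) : Prop where
  mem : ∀ i, F i ∈ gamma0Space N (wt i)
  span : ∀ (m : ℤ) (f : ℍ → ℂ), f ∈ gamma0Space N m →
    ∃ p : Fin r → ℍ → ℂ, (∀ i, p i ∈ levelOneSpace (m - wt i)) ∧ f = ∑ i, p i * F i
  indep : ∀ (m : ℤ) (p : Fin r → ℍ → ℂ), (∀ i, p i ∈ levelOneSpace (m - wt i)) →
    ∑ i, p i * F i = 0 → ∀ i, p i = 0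

/-- **`M(Γ₀(N))` is a free `M(SL₂(ℤ))`-module on at most `μ = [SL₂(ℤ) : Γ₀(N)]` homogeneous
generators of even nonnegative weights** (the Ind-from-`Γ₀(N)` case of the Marks–Mason free-module
theorem, `H(ρ)` free of rank `dim ρ` over `ℂ[E₄, E₆]`; the rank is exactly `μ`, the lower bound
being supplied separately). [cite: Gannon2014, Thm. 3.4] -/
theorem exists_isLevelOneBasis : ∃ (r : ℕ) (wt : Fin r → ℤ) (F : Fin r → ℍ → ℂ),
    IsLevelOneBasis N wt F ∧ r ≤ gamma0Index N ∧ ∀ i, 0 ≤ wt i ∧ Even (wt i) := by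
  classical
  obtain ⟨K₀, hK₀⟩ := exists_fst_le N
  set s := genBelow N K₀ with hs
  have hall : ∀ m, K₀ ≤ m → genBelow N m = s := fun m hm ↦ by
    ext j
    simp only [mem_genBelow, hs]
    exact ⟨fun _ ↦ hK₀ j, fun _ ↦ (hK₀ j).trans hm⟩
  -- sums over `genBelow N m.toNat` are sums over `s`
  have hsum : ∀ (m : ℤ) (p : GenIndex N → ℍ → ℂ), (∀ j, p j ∈ levelOneSpace (m - j.wt)) →
      ∑ j ∈ genBelow N m.toNat, p j * j.fn = ∑ j ∈ s, p j * j.fn := by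
    intro m p hp
    rcases le_or_gt K₀ m.toNat with h | h
    · rw [hall _ h]
    · exact (sum_genBelow_eq N h.le hp).symm
  set r := s.card
  let e : Fin r ≃ s := s.equivFin.symm
  refine ⟨r, fun i ↦ (e i : GenIndex N).wt, fun i ↦ (e i : GenIndex N).fn, ⟨fun i ↦ ?_, ?_, ?_⟩,
    card_genBelow_le N K₀, fun i ↦ ⟨GenIndex.wt_nonneg N _, ?_⟩⟩
  · exact GenIndex.fn_mem N _
  · intro m f hf
    obtain ⟨p, hp, hf⟩ := exists_coeffs N m hf
    refine ⟨fun i ↦ p (e i), fun i ↦ hp _, ?_⟩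
    rw [hf, hsum m p hp, ← Finset.sum_coe_sort s, ← e.sum_comp]
  · intro m p hp h0 i
    let P : GenIndex N → ℍ → ℂ := fun j ↦ if h : j ∈ s then p (e.symm ⟨j, h⟩) else 0
    have hP : ∀ j, P j ∈ levelOneSpace (m - j.wt) := fun j ↦ by
      by_cases h : j ∈ s
      · simp only [P, h, dif_pos]
        have := hp (e.symm ⟨j, h⟩)
        simpa using this
      · simp only [P, h, dif_neg, not_false_eq_true]
        exact Submodule.zero_mem _
    have hPsum : ∑ j ∈ genBelow N m.toNat, P j * j.fn = 0 := by
      rw [hsum m P hP, ← Finset.sum_coe_sort s, ← e.sum_comp, ← h0]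
      refine Finset.sum_congr rfl fun i _ ↦ ?_
      simp [P, (e i).2]
    have := coeffs_eq_zero N m P hP hPsum (e i)
    simpa [P, (e i).2] using this
  · simp only [GenIndex.wt]
    exact_mod_cast GenIndex.even_fst N _

end Gamma0

end Literature.NumberTheory.EllipticCurves.ModularForms
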